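import Mathlib
import Summits.QuantumAdvantage.QuantumAdvantage.Theorems.MobiusLadderQuadraticDigitPhasesStubUwcOpCoreFalseLemmas

/-!
# `QuadraticDigitPhases` (stmt-QuantumAdvantage-1391), line `Sketch` — stub `stub_uwcOpCoreFalse`

REFUTATION of the v24–v29 core `stub_uwcOpCore` of the line (registered in skeleton v30 as the negated
statement `stub_uwcOpCoreFalse`).  WITNESS: `(p, q) = (3, 5)`, `R₀ = 3`, `δ = 1/2`; given the `s, g`
produced by the refuted statement put `G = s + 1`, `b t = 2Gt + 1`, `k t = 2Gt + G + 1`, `N = 2Gg + 1`,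
`n = N + 2`, `BF = {b t : t < g} ∪ {N}`, `KF = {k t : t < g} ∪ {N + 1}`, the interleaved product pattern
`a i j = 1 ⟺ (i ∈ BF ∧ j ∈ KF) ∨ (i ∈ KF ∧ j ∈ BF)` (pair coefficients of `(Σ_{BF} x)(Σ_{KF} x)`), no
linear terms, and the family `μ` DEFINED by the recursion (by `Nat.rec`).  Then every digit cut has rank
`≤ 2 < R₀` (`cutRank_le`: the cut matrix is `1[b-row] ⊗ 1[k-col] + 1[k-row] ⊗ 1[b-col]`), the `g` pairs
`(b t, k t)` are sequential far pairs of span `G > s`, every birth `t ≥ 1` is dependent (row `b t` = row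
`b 0` = indicator of `KF`), so the loss-count inequality `g ≤ (R₀ - 1) + (g - 1) + _` holds, and by
`stub_uwcFalseMass` of the lemma file `Σ |μ_N| = 2^N > 2^N / 2`.
-/

set_option linter.dupNamespace false -- D-0017: single-problem summit ⇒ `QuantumAdvantage.QuantumAdvantage` by design

namespace Summit.QuantumAdvantage.QuantumAdvantage.Theorems.MobiusLadderQuadraticDigitPhasesStubUwcOpCoreFalse

open Finset
open Summit.QuantumAdvantage.QuantumAdvantage.Theorems.MobiusLadderQuadraticDigitPhasesStubUwcOpCoreFalseLemmas

/-- Sub-additivity of the rank of matrices over a field (folklore). -/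
theorem rank_add_le {m k K : Type*} [Fintype m] [Fintype k] [Field K] (A B : Matrix m k K) :
    (A + B).rank ≤ A.rank + B.rank := by
  -- adapted from `Literature/Computability/AlgebraicComplexity/HessianRank.lean`
  unfold Matrix.rank
  rw [Matrix.mulVecLin_add]
  exact (Submodule.finrank_mono (LinearMap.range_add_le _ _)).trans
    (Submodule.finrank_add_le_finrank_add_finrank _ _)

/-- CUT RANK of the interleaved product pattern: every digit cut `[i < c ≤ j]` is the sum of the two
rank-one matrices `1[i ∈ BF, i < c] 1[j ∈ KF, c ≤ j]` and `1[i ∈ KF, i < c] 1[j ∈ BF, c ≤ j]`. -/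
theorem cutRank_le (BF KF : Finset ℕ) (a : ℕ → ℕ → ZMod 2)
    (ha : ∀ i j, a i j = if (i ∈ BF ∧ j ∈ KF) ∨ (i ∈ KF ∧ j ∈ BF) then 1 else 0)
    (hdisj : ∀ i, i ∈ BF → i ∉ KF) (n c : ℕ) :
    (Matrix.of fun (i j : Fin n) => if (i : ℕ) < c ∧ c ≤ (j : ℕ) then a i j else 0).rank ≤ 2 := by
  have hM : (Matrix.of fun (i j : Fin n) => if (i : ℕ) < c ∧ c ≤ (j : ℕ) then a i j else 0) =
      Matrix.vecMulVec (fun i : Fin n => if (i : ℕ) < c ∧ (i : ℕ) ∈ BF then (1 : ZMod 2) else 0)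
          (fun j : Fin n => if c ≤ (j : ℕ) ∧ (j : ℕ) ∈ KF then (1 : ZMod 2) else 0) +
        Matrix.vecMulVec (fun i : Fin n => if (i : ℕ) < c ∧ (i : ℕ) ∈ KF then (1 : ZMod 2) else 0)
          (fun j : Fin n => if c ≤ (j : ℕ) ∧ (j : ℕ) ∈ BF then (1 : ZMod 2) else 0) := by
    ext i j
    simp only [Matrix.of_apply, Matrix.add_apply, Matrix.vecMulVec_apply, ha]
    by_cases hic : (i : ℕ) < c
    · by_cases hcj : c ≤ (j : ℕ)
      · by_cases hiB : (i : ℕ) ∈ BF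
        · have hiK : (i : ℕ) ∉ KF := hdisj _ hiB
          by_cases hjK : (j : ℕ) ∈ KF <;> simp [hic, hcj, hiB, hiK, hjK]
        · by_cases hiK : (i : ℕ) ∈ KF
          · by_cases hjB : (j : ℕ) ∈ BF <;> simp [hic, hcj, hiB, hiK, hjB]
          · simp [hic, hcj, hiB, hiK]
      · simp [hic, hcj]
    · simp [hic]
  rw [hM]
  exact (rank_add_le _ _).trans
    (Nat.add_le_add (Matrix.rank_vecMulVec_le _ _) (Matrix.rank_vecMulVec_le _ _))

/-- REFUTATION of the v24–v29 core `stub_uwcOpCore` (far-pair-count-driven contraction; registered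
negation, skeleton v30 of crux stmt-QuantumAdvantage-1391, line Sketch): the interleaved product pattern
`(Σ_t x_{b_t} + x_N)(Σ_t x_{k_t} + x_{N+1})` at `(p, q) = (3, 5)`, `R₀ = 3`, `δ = 1/2` has cut rank `≤ 2`,
`g` sequential far pairs of span `s + 1` for every `s, g`, satisfies the loss-count inequality (all
births `t ≥ 1` are dependent), and the family defined by the transfer recursion has `ℓ¹` mass exactly
`2^N > 2^N / 2`. -/
theorem stub_uwcOpCoreFalse : ¬ (
    ∀ p q : ℕ, p.Prime → q.Prime → p ≠ q → 2 < p → 2 < q → ∀ R₀ : ℕ, ∀ δ : ℝ, 0 < δ → ∃ s g : ℕ,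
      ∀ (n N : ℕ) (a : ℕ → ℕ → ZMod 2) (l : ℕ → ZMod 2) (b k : ℕ → ℕ), N ≤ n → (∀ c : ℕ, (Matrix.of fun (i j : Fin n) => if (i : ℕ) < c ∧ c ≤ (j : ℕ) then a i j else 0).rank < R₀) →
      (∀ t, t < g → b t < k t ∧ k t < N ∧ s < k t - b t ∧ a (b t) (k t) ≠ 0) → (∀ t, t + 1 < g → k t ≤ b (t + 1)) →
      g ≤ (R₀ - 1) + ((Finset.range g).filter (fun t => (∃ S ∈ (Finset.range t).powerset, ∀ j ∈ Finset.range n, b t < j → a (b t) j = ∑ i ∈ S, a (b i) j))).card + ((Finset.range N).filter (fun c => (∃ S ∈ (Finset.range g).powerset, S.Nonempty ∧ (∀ i ∈ S, b i < c) ∧ (∑ i ∈ S, a (b i) c = 1) ∧ ∀ j ∈ Finset.range n, c < j → ∑ i ∈ S, a (b i) j = 0))).card →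
      ∀ μ : ℕ → ℕ × ℕ → (Fin n → ZMod 2) → (Fin n → ZMod 2) → ℝ, (∀ x π π', μ 0 x π π' = if x = (0, 0) ∧ π = 0 ∧ π' = 0 then 1 else 0) →
      (∀ N', N' < N → ∀ x' ρ ρ', μ (N' + 1) x' ρ ρ' =
          ∑ x ∈ Finset.range p ×ˢ Finset.range q, ∑ π : Fin n → ZMod 2, ∑ π' : Fin n → ZMod 2, ∑ t ∈ Finset.range 2,
            (if ((p * t + x.1) / 2 = x'.1 ∧ (q * t + x.2) / 2 = x'.2 ∧ (fun j : Fin n => if N' + 1 ≤ (j : ℕ) then π j + a N' (j : ℕ) * (if (p * t + x.1) % 2 = 1 then (1 : ZMod 2) else 0) else 0) = ρ ∧ (fun j : Fin n => if N' + 1 ≤ (j : ℕ) then π' j + a N' (j : ℕ) * (if (q * t + x.2) % 2 = 1 then (1 : ZMod 2) else 0) else 0) = ρ') then (if (if (p * t + x.1) % 2 = 1 then (1 : ZMod 2) else 0) * ((if h : N' < n then π ⟨N', h⟩ else 0) + l N') + (if (q * t + x.2) % 2 = 1 then (1 : ZMod 2) else 0) * ((if h : N' < n then π' ⟨N', h⟩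 else 0) + l N') = 1 then (-1 : ℝ) else 1) * μ N' x π π' else 0)) →
      ∑ x ∈ Finset.range p ×ˢ Finset.range q, ∑ π : Fin n → ZMod 2, ∑ π' : Fin n → ZMod 2, |μ N x π π'| ≤ δ * (2 : ℝ) ^ N) := by
  intro H
  obtain ⟨s, g, hmain⟩ := H 3 5 Nat.prime_three Nat.prime_five (by norm_num) (by norm_num)
    (by norm_num) 3 (1 / 2) (by norm_num)
  -- the witness positions
  obtain ⟨G, hG⟩ : ∃ G : ℕ, G = s + 1 := ⟨_, rfl⟩
  obtain ⟨b, hb⟩ : ∃ b : ℕ → ℕ, ∀ t, b t = 2 * (G * t) + 1 := ⟨fun t => 2 * (G * t) + 1, fun _ => rfl⟩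
  obtain ⟨k, hk⟩ : ∃ k : ℕ → ℕ, ∀ t, k t = 2 * (G * t) + G + 1 :=
    ⟨fun t => 2 * (G * t) + G + 1, fun _ => rfl⟩
  obtain ⟨N, hN⟩ : ∃ N : ℕ, N = 2 * (G * g) + 1 := ⟨_, rfl⟩
  obtain ⟨n, hn⟩ : ∃ n : ℕ, n = N + 2 := ⟨_, rfl⟩
  obtain ⟨BF, hBF⟩ : ∃ BF : Finset ℕ, BF = (Finset.range g).image b ∪ {N} := ⟨_, rfl⟩
  obtain ⟨KF, hKF⟩ : ∃ KF : Finset ℕ, KF = (Finset.range g).image k ∪ {N + 1} := ⟨_, rfl⟩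
  -- the pattern, the (absent) linear terms and the family defined by the recursion
  obtain ⟨a, ha⟩ : ∃ a : ℕ → ℕ → ZMod 2, ∀ i j, a i j = if (i ∈ BF ∧ j ∈ KF) ∨ (i ∈ KF ∧ j ∈ BF) then 1 else 0 :=
    ⟨fun i j => if (i ∈ BF ∧ j ∈ KF) ∨ (i ∈ KF ∧ j ∈ BF) then 1 else 0, fun _ _ => rfl⟩
  obtain ⟨l, hl⟩ : ∃ l : ℕ → ZMod 2, ∀ j, l j = 0 := ⟨fun _ => 0, fun _ => rfl⟩
  obtain ⟨μ, hμ0, hstep⟩ : ∃ μ : ℕ → ℕ × ℕ → (Fin n → ZMod 2) → (Fin n → ZMod 2) → ℝ,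
      (∀ x π π', μ 0 x π π' = if x = (0, 0) ∧ π = 0 ∧ π' = 0 then 1 else 0) ∧
      (∀ N' x' ρ ρ', μ (N' + 1) x' ρ ρ' =
        ∑ x ∈ Finset.range 3 ×ˢ Finset.range 5, ∑ π : Fin n → ZMod 2, ∑ π' : Fin n → ZMod 2, ∑ t ∈ Finset.range 2,
            (if ((3 * t + x.1) / 2 = x'.1 ∧ (5 * t + x.2) / 2 = x'.2 ∧ (fun j : Fin n => if N' + 1 ≤ (j : ℕ) then π j + a N' (j : ℕ) * (if (3 * t + x.1) % 2 = 1 then (1 : ZMod 2) else 0) else 0) = ρ ∧ (fun j : Fin n => if N' + 1 ≤ (j : ℕ) then π' j + a N' (j : ℕ) * (if (5 * t + x.2) % 2 = 1 then (1 : ZMod 2) else 0) else 0) = ρ') then (if (if (3 * t + x.1) % 2 = 1 then (1 : ZMod 2) else 0) * ((if h : N' < n then π ⟨N', h⟩ else 0) + l N') + (if (5 * t + x.2) % 2 = 1 then (1 : ZMod 2) else 0) * ((if h : N' < n then π' ⟨N', h⟩ else 0) + l N') = 1 then (-1 : ℝ) else 1) * μ N' x π π' else 0)) :=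
    ⟨fun M => Nat.rec (motive := fun _ => ℕ × ℕ → (Fin n → ZMod 2) → (Fin n → ZMod 2) → ℝ)
        (fun x π π' => if x = (0, 0) ∧ π = 0 ∧ π' = 0 then 1 else 0)
        (fun N' μN' x' ρ ρ' =>
          ∑ x ∈ Finset.range 3 ×ˢ Finset.range 5, ∑ π : Fin n → ZMod 2, ∑ π' : Fin n → ZMod 2, ∑ t ∈ Finset.range 2,
            (if ((3 * t + x.1) / 2 = x'.1 ∧ (5 * t + x.2) / 2 = x'.2 ∧ (fun j : Fin n => if N' + 1 ≤ (j : ℕ) then π j + a N' (j : ℕ) * (if (3 * t + x.1) % 2 = 1 then (1 : ZMod 2) else 0) else 0) = ρ ∧ (fun j : Fin n => if N' + 1 ≤ (j : ℕ) then π' j + a N' (j : ℕ) * (if (5 * t + x.2) % 2 = 1 then (1 : ZMod 2) else 0) else 0) = ρ') then (if (if (3 * t + x.1) % 2 = 1 then (1 : ZMod 2) else 0) * ((if h : N' < n then π ⟨N', h⟩ else 0) + l N') + (if (5 * t + x.2) % 2 = 1 then (1 : ZMod 2) else 0) * ((if h : N' < n then π' ⟨N', h⟩ else 0) + l N') = 1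 then (-1 : ℝ) else 1) * μN' x π π' else 0)) M,
      fun _ _ _ => rfl, fun _ _ _ _ => rfl⟩
  -- arithmetic of the positions
  have hkN : ∀ t, t < g → k t < N := by
    intro t ht
    have h1 : G * (t + 1) ≤ G * g := Nat.mul_le_mul_left G ht
    have h2 : G * (t + 1) = G * t + G := by ring
    rw [hk, hN]
    omega
  have hbk : ∀ t t', b t ≠ k t' := by
    intro t t' h
    rw [hb, hk] at h
    have h3 : G * (2 * t) = G * (2 * t' + 1) := by nlinarith
    have h4 := Nat.eq_of_mul_eq_mul_left (by omega) h3
    omega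
  have hmemB : ∀ i, i ∈ BF ↔ i = N ∨ (∃ t, t < g ∧ b t = i) := by
    intro i
    simp [hBF, Finset.mem_image, Finset.mem_range]
  have hmemK : ∀ i, i ∈ KF ↔ i = N + 1 ∨ (∃ t, t < g ∧ k t = i) := by
    intro i
    simp [hKF, Finset.mem_image, Finset.mem_range]
  have hdisj : ∀ i, i ∈ BF → i ∉ KF := by
    intro i hiB hiK
    rw [hmemB] at hiB
    rw [hmemK] at hiK
    rcases hiB with rfl | ⟨t, ht, rfl⟩
    · rcases hiK with h | ⟨t', ht', h⟩
      · omega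
      · exact absurd h (hkN t' ht').ne
    · rcases hiK with h | ⟨t', ht', h⟩
      · rw [hb, hN] at h
        omega
      · exact hbk t t' h.symm
  have hBN : N ∈ BF := (hmemB N).mpr (Or.inl rfl)
  have hKN : N + 1 ∈ KF := (hmemK (N + 1)).mpr (Or.inl rfl)
  have hbB : ∀ t, t < g → b t ∈ BF := fun t ht => (hmemB _).mpr (Or.inr ⟨t, ht, rfl⟩)
  have hkK : ∀ t, t < g → k t ∈ KF := fun t ht => (hmemK _).mpr (Or.inr ⟨t, ht, rfl⟩)
  have hrowB : ∀ t, t < g → ∀ j, a (b t) j = if j ∈ KF then 1 else 0 := by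
    intro t ht j
    have h1 := hbB t ht
    have h2 := hdisj _ h1
    simp [ha, h1, h2]
  -- the hypotheses of the refuted statement
  have hNn : N ≤ n := by omega
  have hcut : ∀ c : ℕ, (Matrix.of fun (i j : Fin n) =>
      if (i : ℕ) < c ∧ c ≤ (j : ℕ) then a i j else 0).rank < 3 :=
    fun c => lt_of_le_of_lt (cutRank_le BF KF a ha hdisj n c) (by norm_num)
  have hpairs : ∀ t, t < g → b t < k t ∧ k t < N ∧ s < k t - b t ∧ a (b t) (k t) ≠ 0 := by
    intro t ht
    refine ⟨by rw [hb, hk]; omega, hkN t ht, by rw [hb, hk]; omega, ?_⟩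
    rw [hrowB t ht, if_pos (hkK t ht)]
    exact one_ne_zero
  have hseq : ∀ t, t + 1 < g → k t ≤ b (t + 1) := by
    intro t _
    rw [hk, hb]
    have h2 : G * (t + 1) = G * t + G := by ring
    omega
  have hdep : Finset.Ico 1 g ⊆ (Finset.range g).filter (fun t => (∃ S ∈ (Finset.range t).powerset,
      ∀ j ∈ Finset.range n, b t < j → a (b t) j = ∑ i ∈ S, a (b i) j)) := by
    intro t ht
    rw [Finset.mem_Ico] at ht
    rw [Finset.mem_filter]
    refine ⟨Finset.mem_range.mpr ht.2, {0}, ?_, ?_⟩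
    · exact Finset.mem_powerset.mpr (Finset.singleton_subset_iff.mpr (Finset.mem_range.mpr ht.1))
    · intro j _ _
      rw [Finset.sum_singleton, hrowB t ht.2, hrowB 0 (by omega)]
  have hloss : g ≤ (3 - 1) + ((Finset.range g).filter (fun t => (∃ S ∈ (Finset.range t).powerset,
      ∀ j ∈ Finset.range n, b t < j → a (b t) j = ∑ i ∈ S, a (b i) j))).card +
      ((Finset.range N).filter (fun c => (∃ S ∈ (Finset.range g).powerset, S.Nonempty ∧
        (∀ i ∈ S, b i < c) ∧ (∑ i ∈ S, a (b i) c = 1) ∧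
        ∀ j ∈ Finset.range n, c < j → ∑ i ∈ S, a (b i) j = 0))).card := by
    have hcard := Finset.card_le_card hdep
    rw [Nat.card_Ico] at hcard
    omega
  -- the recursively defined family refutes the bound
  have key := hmain n N a l b k hNn hcut hpairs hseq hloss μ hμ0 (fun N' _ x' ρ ρ' => hstep N' x' ρ ρ')
  rw [stub_uwcFalseMass n BF KF a ha 3 5 N (show N + 1 < n by omega) hBN hKN hdisj (by norm_num)
    (by norm_num) l hl μ hμ0 (fun N' _ x' ρ ρ' => hstep N' x' ρ ρ')] at key
  have h2N : (0 : ℝ) < 2 ^ N := pow_pos two_pos N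
  linarith

end Summit.QuantumAdvantage.QuantumAdvantage.Theorems.MobiusLadderQuadraticDigitPhasesStubUwcOpCoreFalse
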